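import Mathlib
import HarnessLib
import Summits.HubbardSuperconductivity.HubbardSuperconductivity.Theorems.KLProgrammeKLRegimeTwoVolumeTowerTruncDefs

/-!
# Route `KLProgramme` — crux K3, VL child `KLRegimeVolumeLimitV17F2` (stmt-HubbardSuperconductivity-20440), blueprint v5 M5: WHAT THE VOLUME-FREE SMALLNESS
# (H3) FORCES ON THE DEGREE-`2` AND DEGREE-`4` PROFILE BUDGETS — RADII-FREE NECESSARY CONDITIONS (seat hubbard-kl-k3c4-p1 g14; tightness lemmas, `--supports` 20440)

`TowerScaleSmall κ … ρ₀ … NV NS ν₀ …` (`…TowerSpineDefs`, field (H3) `hsm` of `TowerData`/`TowerDataT`) asks `θ₀ = e·aW·ν₀/κ² < 1` with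
`ν₀ = Σ_m (e²(κ+ρ₀))^{2m}·NV m`.  Every term of that series is nonnegative, so each ONE of them is already below `κ²/(e·aW)`; for the degree-`2`
term (`m = 1`) the measuring radius CANCELS against `κ²` (`(κ+ρ₀)² ≥ κ²`), leaving a condition on the budget free of every radius:

* `towerScaleSmall_term_lt` — `e·aW·(e²(κ+ρ₀))^{2m}·NV m/κ² < 1` for every `m`;
* **`towerScaleSmall_exp_five_mul_nv_one_lt`** — `e⁵ · aW · NV 1 < 1`;
* `towerScaleSmall_exp_nine_mul_sq_mul_nv_two_lt` — `e⁹ · aW · κ² · NV 2 < 1`;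
* **`TowerDataT.exp_five_mul_aW_mul_nv_one_lt`** — in any `TowerDataT β U μ`, at every scale `j < nScales β`: `e⁵ · aW j · NV j 1 < 1`.

Reading (located note «SRC-DEG2», k3c4-p1 g14): `aW j / ε` dominates the `(1+Λ_j·tnorm)`-weighted rows of the step covariance `klStepCov … j`
(`TowerVolumeDataT.cov`) and `ε · NV j 1` dominates the weighted pinned profile of the degree-`2` kernels of the source-truncated state
`srcTrunc … 3 (klTowerD … j)` at EVERY label, source copies included (`TowerVolumeDataT.profile`, `m' = 1`); so any `TowerDataT` forces
(weighted row norm of `C_j`) · (weighted pinned degree-`2` profile of `D_j`, alive AND source legs) `< e⁻⁵` at every scale — in particular the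
degree-`2` budgets of the source families `s = 1, 2` must carry the scale law (`∝ 4^{−j}`), which a producer text with a FREE degree-`≤ 2`
prefactor does not export.  Proofs only; no definition; nothing asserts any stub, K3, VL or superconductivity. [folklore]
-/

noncomputable section

namespace Summit.HubbardSuperconductivity.HubbardSuperconductivity.Theorems.TwoVolumeSource

set_option linter.dupNamespace false -- summit = problem name (single-conjunct summit), D-0017

open Finset Filter Topology
open Summit.HubbardSuperconductivity.HubbardSuperconductivity.Theorems.KLProgrammeLegKernels
open Summit.HubbardSuperconductivity.HubbardSuperconductivity.Theorems.KLRegimeSplit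
open Summit.HubbardSuperconductivity.HubbardSuperconductivity.Theorems.EngineV8
open Summit.HubbardSuperconductivity.HubbardSuperconductivity.Theorems.TwoPointAssembly

/-- `e · (e²)² = e⁵`. [folklore] -/
theorem exp_one_mul_exp_two_sq : Real.exp 1 * Real.exp 2 ^ 2 = Real.exp 5 := by
  rw [sq, ← Real.exp_add, ← Real.exp_add]; norm_num

/-- `e · (e²)⁴ = e⁹`. [folklore] -/
theorem exp_one_mul_exp_two_pow_four : Real.exp 1 * Real.exp 2 ^ 4 = Real.exp 9 := by
  rw [show (4 : ℕ) = 1 + 1 + 1 + 1 from rfl, pow_succ, pow_succ, pow_succ, pow_one, ← Real.exp_add, ← Real.exp_add, ← Real.exp_add,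
    ← Real.exp_add]
  norm_num

variable {κ κ' aW aW' cW κf cRb cCb δb ρ₀ ρf ρ₂ ρ' ρ₃ : ℝ} {NV NS : ℕ → ℝ} {ν₀ ν₁ ν₂ ν₃ ν₄ ν₅ νE ν₆ ν₇ ν₈ : ℝ}

/-- **Every single term of `ν₀` is below the smallness threshold**: `e·aW·(e²(κ+ρ₀))^{2m}·NV m/κ² < 1`. [folklore] -/
theorem towerScaleSmall_term_lt (h : TowerScaleSmall κ κ' aW aW' cW κf cRb cCb δb ρ₀ ρf ρ₂ ρ' ρ₃ NV NS ν₀ ν₁ ν₂ ν₃ ν₄ ν₅ νE ν₆ ν₇ ν₈)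
    (hκ : 0 < κ) (hρ₀ : 0 ≤ ρ₀) (haW : 0 ≤ aW) (hNV : ∀ m, 0 ≤ NV m) (m : ℕ) :
    Real.exp 1 * aW * ((Real.exp 2 * (κ + ρ₀)) ^ (2 * m) * NV m) / κ ^ 2 < 1 := by
  have hw : 0 ≤ Real.exp 2 * (κ + ρ₀) := by positivity
  have hterm : (Real.exp 2 * (κ + ρ₀)) ^ (2 * m) * NV m ≤ ν₀ :=
    le_hasSum h.hν₀ m fun m' _ => mul_nonneg (pow_nonneg hw _) (hNV m')
  have hk2 : 0 < κ ^ 2 := pow_pos hκ 2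
  calc Real.exp 1 * aW * ((Real.exp 2 * (κ + ρ₀)) ^ (2 * m) * NV m) / κ ^ 2 ≤ Real.exp 1 * aW * ν₀ / κ ^ 2 :=
        div_le_div_of_nonneg_right (mul_le_mul_of_nonneg_left hterm (by positivity)) hk2.le
    _ < 1 := h.hθ₀

/-- **THE DEGREE-`2` BUDGET IS BELOW `e⁻⁵/aW`, WHATEVER THE RADII** (see the module docstring). [folklore] -/
theorem towerScaleSmall_exp_five_mul_nv_one_lt
    (h : TowerScaleSmall κ κ' aW aW' cW κf cRb cCb δb ρ₀ ρf ρ₂ ρ' ρ₃ NV NS ν₀ ν₁ ν₂ ν₃ ν₄ ν₅ νE ν₆ ν₇ ν₈)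
    (hκ : 0 < κ) (hρ₀ : 0 ≤ ρ₀) (haW : 0 ≤ aW) (hNV : ∀ m, 0 ≤ NV m) :
    Real.exp 5 * aW * NV 1 < 1 := by
  have hk2 : 0 < κ ^ 2 := pow_pos hκ 2
  have hκρ : κ ^ 2 ≤ (κ + ρ₀) ^ 2 := pow_le_pow_left₀ hκ.le (le_add_of_nonneg_right hρ₀) 2
  have hcmp : Real.exp 2 ^ 2 * κ ^ 2 * NV 1 ≤ (Real.exp 2 * (κ + ρ₀)) ^ (2 * 1) * NV 1 := by
    rw [mul_one, mul_pow]
    exact mul_le_mul_of_nonneg_right (mul_le_mul_of_nonneg_left hκρ (by positivity)) (hNV 1)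
  calc Real.exp 5 * aW * NV 1 = Real.exp 1 * aW * (Real.exp 2 ^ 2 * κ ^ 2 * NV 1) / κ ^ 2 := by
        rw [← exp_one_mul_exp_two_sq]; field_simp
    _ ≤ Real.exp 1 * aW * ((Real.exp 2 * (κ + ρ₀)) ^ (2 * 1) * NV 1) / κ ^ 2 :=
        div_le_div_of_nonneg_right (mul_le_mul_of_nonneg_left hcmp (by positivity)) hk2.le
    _ < 1 := towerScaleSmall_term_lt h hκ hρ₀ haW hNV 1

/-- **The degree-`4` budget is below `e⁻⁹/(aW·κ²)`, whatever the radii.** [folklore] -/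
theorem towerScaleSmall_exp_nine_mul_sq_mul_nv_two_lt
    (h : TowerScaleSmall κ κ' aW aW' cW κf cRb cCb δb ρ₀ ρf ρ₂ ρ' ρ₃ NV NS ν₀ ν₁ ν₂ ν₃ ν₄ ν₅ νE ν₆ ν₇ ν₈)
    (hκ : 0 < κ) (hρ₀ : 0 ≤ ρ₀) (haW : 0 ≤ aW) (hNV : ∀ m, 0 ≤ NV m) :
    Real.exp 9 * aW * κ ^ 2 * NV 2 < 1 := by
  have hk2 : 0 < κ ^ 2 := pow_pos hκ 2
  have hκρ : κ ^ 4 ≤ (κ + ρ₀) ^ 4 := pow_le_pow_left₀ hκ.le (le_add_of_nonneg_right hρ₀) 4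
  have hcmp : Real.exp 2 ^ 4 * κ ^ 4 * NV 2 ≤ (Real.exp 2 * (κ + ρ₀)) ^ (2 * 2) * NV 2 := by
    rw [show 2 * 2 = 4 from rfl, mul_pow]
    exact mul_le_mul_of_nonneg_right (mul_le_mul_of_nonneg_left hκρ (by positivity)) (hNV 2)
  calc Real.exp 9 * aW * κ ^ 2 * NV 2 = Real.exp 1 * aW * (Real.exp 2 ^ 4 * κ ^ 4 * NV 2) / κ ^ 2 := by
        rw [← exp_one_mul_exp_two_pow_four]; field_simp
    _ ≤ Real.exp 1 * aW * ((Real.exp 2 * (κ + ρ₀)) ^ (2 * 2) * NV 2) / κ ^ 2 :=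
        div_le_div_of_nonneg_right (mul_le_mul_of_nonneg_left hcmp (by positivity)) hk2.le
    _ < 1 := towerScaleSmall_term_lt h hκ hρ₀ haW hNV 2

/-- **IN ANY `TowerDataT β U μ` THE DEGREE-`2` BUDGET OF EVERY STEP OBEYS `e⁵ · aW j · NV j 1 < 1`** (see the module docstring). [folklore] -/
theorem TowerDataT.exp_five_mul_aW_mul_nv_one_lt {β U μ : ℝ} (D : TowerDataT β U μ) {j : ℕ} (hj : j < nScales β) :
    Real.exp 5 * D.aW j * D.NV j 1 < 1 :=
  towerScaleSmall_exp_five_mul_nv_one_lt (D.hsm j hj) (D.hκ j).1 (D.hρ j).1.le (D.haW j).1 (D.hNV0 j)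

/-- The degree-`4` twin: `e⁹ · aW j · (κ j)² · NV j 2 < 1` at every scale `j < nScales β` of any `TowerDataT β U μ`. [folklore] -/
theorem TowerDataT.exp_nine_mul_aW_mul_sq_mul_nv_two_lt {β U μ : ℝ} (D : TowerDataT β U μ) {j : ℕ} (hj : j < nScales β) :
    Real.exp 9 * D.aW j * D.κ j ^ 2 * D.NV j 2 < 1 :=
  towerScaleSmall_exp_nine_mul_sq_mul_nv_two_lt (D.hsm j hj) (D.hκ j).1 (D.hρ j).1.le (D.haW j).1 (D.hNV0 j)

end Summit.HubbardSuperconductivity.HubbardSuperconductivity.Theorems.TwoVolumeSource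

end
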